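import Summits.QuantumFields.GaugeBoot.SOMasterLoopAssembly
import Literature.MathematicalPhysics.QuantumFieldTheory.Chatterjee2019LargeN.MasterLoopConvergence
import Literature.MathematicalPhysics.QuantumFieldTheory.Sweep1AreaLawProofs
import Mathlib.Probability.Independence.InfinitePi
import HarnessLib

/-!
# Coordinate-permutation covariance of the free-boundary `SO(N)` lattice gauge theory (gauge-boot, ADDENDUM 28 part Z2)

HONEST FRAMING (cell `pub-gaugeboot`, page 1 of every file): the venture produces certified bounds
on lattice expectations at stated coupling, gauge group, dimension and torus size; NOT a mass gap,
NOT a continuum limit, NOT a string tension; NOT Yang–Mills-summit-bearing (barriers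
`FixedCouplingUltralocality`, `PerturbativeInvisibility`).  Exact finite-volume symmetry statements for the free-boundary
`SO(N)` lattice gauge theory of S. Chatterjee, Comm. Math. Phys. **366** (2019); nothing about four-dimensional continuum
Yang–Mills or a mass gap.

## Content

A permutation `σ` of the coordinate axes of `ℤ^d` acts on sites (`x ↦ x ∘ σ⁻¹`), on positively oriented edges
(`(x, k) ↦ (x ∘ σ⁻¹, σ k)`), hence on configurations (`(σ·U)(x ∘ σ⁻¹, σ k) = U(x, k)`, i.e. `σ·U = U ∘ σ_E⁻¹`).  Facts:
* `integral_comp_permConfig` — the infinite Haar product `dg_∞` is invariant (Mathlib's `map_infinitePi_infinitePi_of_inj`);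
* `plaquette_permConfig` — `(σ·U)_{σp} = U_p` for the plaquette holonomies (with `U_{(x,j,i)} = U_{(x,i,j)}⁻¹` when `σ`
  reverses the order of the two axes, `plaquette_swap`);
* `zdWilsonAction_permConfig` — for a `σ`-invariant region `Λ` the `SO(N)` Wilson action is invariant, hence
  ★ `soExpect_comp_permConfig`: `⟨F ∘ σ·⟩_{Λ,N,β} = ⟨F⟩_{Λ,N,β}`;
* `wilsonLoopVar_map_permConfig` — `W_{σl}(σ·U) = W_l(U)`; `plaquetteWord_perm` — `∂(σp) = σ(∂p)` when `σ` preserves the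
  order of the two axes of `p`; whence ★ `phi_plaquetteWord_perm`: `φ_{Λ,N,β}((∂(σp))) = φ_{Λ,N,β}((∂p))` for `σ`-invariant `Λ`.
These feed the plaquette-independence of the string sum `Σ_X w_β(X)` over `𝒳((∂p))` (sibling `PlaquetteStringSum`), the
input of the source's Corollary 3.4.

Everything is `[folklore]` (lattice symmetries of the Wilson action).
-/

noncomputable section

open MeasureTheory Filter Topology
open Literature.Probability.LatticeModels (Site)
open Literature.MathematicalPhysics.QuantumLattice (LGConfig ZdEdge ZdPlaquette)
open Literature.MathematicalPhysics.QuantumFieldTheory (ZdGaugeConfig zdHaar zdWilsonMeasure zdWilsonAction zdExpect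
  plaquettesIn)
open Literature.MathematicalPhysics.QuantumFieldTheory.AreaLaw (zdExpect_eq_div_integral)
open Literature.MathematicalPhysics.QuantumFieldTheory.Chatterjee2019LargeN

namespace Summit.QuantumFields.GaugeBoot

namespace StringDuality

variable {d N : ℕ}

/-! ## The action of a coordinate permutation on sites -/

/-- `(x + y) ∘ σ⁻¹ = x ∘ σ⁻¹ + y ∘ σ⁻¹`. [folklore] -/
theorem add_comp_perm (x y : Site d) (τ : Fin d → Fin d) : (x + y) ∘ τ = x ∘ τ + y ∘ τ := by
  funext i; simp

/-- `e_k ∘ σ⁻¹ = e_{σ k}`. [folklore] -/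
theorem single_comp_perm_symm (σ : Equiv.Perm (Fin d)) (k : Fin d) :
    (Pi.single k (1 : ℤ) : Site d) ∘ ⇑σ.symm = Pi.single (σ k) 1 := by
  funext i
  simp only [Function.comp_apply, Pi.single_apply, Equiv.symm_apply_eq]

/-- `e_k ∘ σ = e_{σ⁻¹ k}`. [folklore] -/
theorem single_comp_perm (σ : Equiv.Perm (Fin d)) (k : Fin d) :
    (Pi.single k (1 : ℤ) : Site d) ∘ ⇑σ = Pi.single (σ.symm k) 1 := by
  have h := single_comp_perm_symm σ.symm k
  simpa using h

/-- `(x ∘ σ⁻¹) ∘ σ = x`. [folklore] -/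
theorem comp_symm_comp (σ : Equiv.Perm (Fin d)) (x : Site d) : (x ∘ ⇑σ.symm) ∘ ⇑σ = x := by
  funext i; simp

/-- `(x ∘ σ) ∘ σ⁻¹ = x`. [folklore] -/
theorem comp_comp_symm (σ : Equiv.Perm (Fin d)) (x : Site d) : (x ∘ ⇑σ) ∘ ⇑σ.symm = x := by
  funext i; simp

/-! ## The action on configurations and the invariance of the Haar product -/

/-- The permuted configuration: `(σ·U)(e) = U(e.1 ∘ σ, σ⁻¹ e.2)`, so that `(σ·U)(x ∘ σ⁻¹, σ k) = U(x, k)`.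
[folklore] -/
theorem permConfig_apply_perm {G : Type*} (σ : Equiv.Perm (Fin d)) (U : ZdGaugeConfig d G) (x : Site d) (k : Fin d) :
    (fun e : ZdEdge d => U (e.1 ∘ ⇑σ, σ.symm e.2)) (x ∘ ⇑σ.symm, σ k) = U (x, k) := by
  simp only [comp_symm_comp, Equiv.symm_apply_apply]

/-- **The infinite Haar product is invariant under coordinate permutations.** [folklore] -/
theorem integral_comp_permConfig {G : Type*} [Group G] [TopologicalSpace G] [IsTopologicalGroup G] [CompactSpace G]
    [MeasurableSpace G] [BorelSpace G] (σ : Equiv.Perm (Fin d)) (f : ZdGaugeConfig d G → ℝ) :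
    ∫ U, f (fun e : ZdEdge d => U (e.1 ∘ ⇑σ, σ.symm e.2)) ∂(zdHaar d G) = ∫ U, f U ∂(zdHaar d G) := by
  -- the reindexing of the edges is a bijection
  have hinj : Function.Injective (fun e : ZdEdge d => ((e.1 ∘ ⇑σ, σ.symm e.2) : ZdEdge d)) := by
    intro e e' h
    simp only [Prod.mk.injEq] at h
    obtain ⟨h1, h2⟩ := h
    refine Prod.ext ?_ (σ.symm.injective h2)
    have := congrArg (fun y : Site d => y ∘ ⇑σ.symm) h1
    simpa [comp_comp_symm] using this
  have hmap : (zdHaar d G).map (fun (U : ZdGaugeConfig d G) (e : ZdEdge d) => U (e.1 ∘ ⇑σ, σ.symm e.2)) = zdHaar d G :=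
    Measure.map_infinitePi_infinitePi_of_inj
      (P := fun _ : ZdEdge d => Literature.MathematicalPhysics.QuantumFieldTheory.haarProbability G) hinj
  -- the configuration map is a measurable equivalence
  let Φ : ZdGaugeConfig d G ≃ᵐ ZdGaugeConfig d G :=
    { toFun := fun U e => U (e.1 ∘ ⇑σ, σ.symm e.2)
      invFun := fun U e => U (e.1 ∘ ⇑σ.symm, σ e.2)
      left_inv := fun U => by
        funext e
        simp only [comp_symm_comp, Equiv.symm_apply_apply]
      right_inv := fun U => by
        funext e
        simp only [comp_comp_symm, Equiv.apply_symm_apply]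
      measurable_toFun := measurable_pi_lambda _ fun e => measurable_pi_apply _
      measurable_invFun := measurable_pi_lambda _ fun e => measurable_pi_apply _ }
  have h := Φ.measurableEmbedding.integral_map (μ := zdHaar d G) f
  change ∫ U, f U ∂((zdHaar d G).map (fun (U : ZdGaugeConfig d G) (e : ZdEdge d) => U (e.1 ∘ ⇑σ, σ.symm e.2))) =
    ∫ U, f (fun e : ZdEdge d => U (e.1 ∘ ⇑σ, σ.symm e.2)) ∂(zdHaar d G) at h
  rw [hmap] at h
  exact h.symm

/-! ## Plaquettes -/

/-- **Plaquette holonomies are permuted**: `(σ·U)_{(x∘σ⁻¹, σi, σj)} = U_{(x,i,j)}`. [folklore] -/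
theorem plaquette_permConfig {G : Type*} [Group G] (σ : Equiv.Perm (Fin d)) (U : ZdGaugeConfig d G) (x : Site d)
    (i j : Fin d) :
    ZdGaugeConfig.plaquette (fun e : ZdEdge d => U (e.1 ∘ ⇑σ, σ.symm e.2)) (x ∘ ⇑σ.symm) (σ i) (σ j) =
      ZdGaugeConfig.plaquette U x i j := by
  unfold ZdGaugeConfig.plaquette
  simp only [add_comp_perm, comp_symm_comp, single_comp_perm, Equiv.symm_apply_apply]

/-- Reversing the two axes inverts the plaquette holonomy: `U_{(x,j,i)} = U_{(x,i,j)}⁻¹`. [folklore] -/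
theorem plaquette_swap {G : Type*} [Group G] (U : ZdGaugeConfig d G) (x : Site d) (i j : Fin d) :
    ZdGaugeConfig.plaquette U x j i = (ZdGaugeConfig.plaquette U x i j)⁻¹ := by
  unfold ZdGaugeConfig.plaquette
  simp only [mul_inv_rev, inv_inv, mul_assoc]

/-- `Re tr` of an `SO(N)` plaquette is orientation independent. [folklore] -/
theorem re_trace_soRep_inv (g : SO N) : (soRep N g⁻¹).trace.re = (soRep N g).trace.re := by
  rw [SOMasterLoop.soRep_inv, Matrix.trace_transpose]

/-! ## The Wilson action and the expectations -/

/-- **The `SO(N)` Wilson action of a `σ`-invariant region is invariant**: `S_Λ(σ·U) = S_Λ(U)`.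
[folklore] -/
theorem zdWilsonAction_permConfig (σ : Equiv.Perm (Fin d)) {Λ : Finset (Site d)}
    (hΛ : ∀ x : Site d, x ∈ Λ ↔ x ∘ ⇑σ.symm ∈ Λ) (U : ZdGaugeConfig d (SO N)) :
    zdWilsonAction (soRep N) Λ (fun e : ZdEdge d => U (e.1 ∘ ⇑σ, σ.symm e.2)) = zdWilsonAction (soRep N) Λ U := by
  have hΛ' : ∀ x : Site d, x ∈ Λ ↔ x ∘ ⇑σ ∈ Λ := fun x => by
    rw [hΛ (x ∘ ⇑σ), comp_comp_symm]
  unfold zdWilsonAction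
  symm
  refine Finset.sum_nbij'
    (fun q : Site d × Fin d × Fin d => (q.1 ∘ ⇑σ.symm, min (σ q.2.1) (σ q.2.2), max (σ q.2.1) (σ q.2.2)))
    (fun q : Site d × Fin d × Fin d => (q.1 ∘ ⇑σ, min (σ.symm q.2.1) (σ.symm q.2.2), max (σ.symm q.2.1) (σ.symm q.2.2)))
    ?_ ?_ ?_ ?_ ?_
  -- the forward map preserves `plaquettesIn Λ`
  · rintro ⟨x, i, j⟩ hq
    obtain ⟨hij, h0, hi, hj, hij'⟩ := SOMasterLoop.mem_plaquettesIn_iff.mp hq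
    have hne : σ i ≠ σ j := fun h => (ne_of_lt hij) (σ.injective h)
    simp only
    rcases lt_or_gt_of_ne hne with hlt | hlt
    · rw [min_eq_left hlt.le, max_eq_right hlt.le, SOMasterLoop.mem_plaquettesIn_iff]
      refine ⟨hlt, (hΛ x).mp h0, ?_, ?_, ?_⟩
      · rw [← single_comp_perm_symm σ i, ← add_comp_perm]; exact (hΛ _).mp hi
      · rw [← single_comp_perm_symm σ j, ← add_comp_perm]; exact (hΛ _).mp hj
      · rw [← single_comp_perm_symm σ i, ← single_comp_perm_symm σ j, ← add_comp_perm, ← add_comp_perm]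
        exact (hΛ _).mp hij'
    · rw [min_eq_right hlt.le, max_eq_left hlt.le, SOMasterLoop.mem_plaquettesIn_iff]
      refine ⟨hlt, (hΛ x).mp h0, ?_, ?_, ?_⟩
      · rw [← single_comp_perm_symm σ j, ← add_comp_perm]; exact (hΛ _).mp hj
      · rw [← single_comp_perm_symm σ i, ← add_comp_perm]; exact (hΛ _).mp hi
      · rw [← single_comp_perm_symm σ i, ← single_comp_perm_symm σ j, ← add_comp_perm, ← add_comp_perm,
          add_right_comm]
        exact (hΛ _).mp hij'
  -- the backward map preserves `plaquettesIn Λ`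
  · rintro ⟨x, i, j⟩ hq
    obtain ⟨hij, h0, hi, hj, hij'⟩ := SOMasterLoop.mem_plaquettesIn_iff.mp hq
    have hne : σ.symm i ≠ σ.symm j := fun h => (ne_of_lt hij) (σ.symm.injective h)
    simp only
    rcases lt_or_gt_of_ne hne with hlt | hlt
    · rw [min_eq_left hlt.le, max_eq_right hlt.le, SOMasterLoop.mem_plaquettesIn_iff]
      refine ⟨hlt, (hΛ' x).mp h0, ?_, ?_, ?_⟩
      · rw [← single_comp_perm σ i, ← add_comp_perm]; exact (hΛ' _).mp hi
      · rw [← single_comp_perm σ j, ← add_comp_perm]; exact (hΛ' _).mp hj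
      · rw [← single_comp_perm σ i, ← single_comp_perm σ j, ← add_comp_perm, ← add_comp_perm]
        exact (hΛ' _).mp hij'
    · rw [min_eq_right hlt.le, max_eq_left hlt.le, SOMasterLoop.mem_plaquettesIn_iff]
      refine ⟨hlt, (hΛ' x).mp h0, ?_, ?_, ?_⟩
      · rw [← single_comp_perm σ j, ← add_comp_perm]; exact (hΛ' _).mp hj
      · rw [← single_comp_perm σ i, ← add_comp_perm]; exact (hΛ' _).mp hi
      · rw [← single_comp_perm σ i, ← single_comp_perm σ j, ← add_comp_perm, ← add_comp_perm, add_right_comm]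
        exact (hΛ' _).mp hij'
  -- left inverse
  · rintro ⟨x, i, j⟩ hq
    obtain ⟨hij, -⟩ := SOMasterLoop.mem_plaquettesIn_iff.mp hq
    have hne : σ i ≠ σ j := fun h => (ne_of_lt hij) (σ.injective h)
    simp only [comp_symm_comp]
    rcases lt_or_gt_of_ne hne with hlt | hlt
    · rw [min_eq_left hlt.le, max_eq_right hlt.le, Equiv.symm_apply_apply, Equiv.symm_apply_apply,
        min_eq_left hij.le, max_eq_right hij.le]
    · rw [min_eq_right hlt.le, max_eq_left hlt.le, Equiv.symm_apply_apply, Equiv.symm_apply_apply,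
        min_eq_right hij.le, max_eq_left hij.le]
  -- right inverse
  · rintro ⟨x, i, j⟩ hq
    obtain ⟨hij, -⟩ := SOMasterLoop.mem_plaquettesIn_iff.mp hq
    have hne : σ.symm i ≠ σ.symm j := fun h => (ne_of_lt hij) (σ.symm.injective h)
    simp only [comp_comp_symm]
    rcases lt_or_gt_of_ne hne with hlt | hlt
    · rw [min_eq_left hlt.le, max_eq_right hlt.le, Equiv.apply_symm_apply, Equiv.apply_symm_apply,
        min_eq_left hij.le, max_eq_right hij.le]
    · rw [min_eq_right hlt.le, max_eq_left hlt.le, Equiv.apply_symm_apply, Equiv.apply_symm_apply,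
        min_eq_right hij.le, max_eq_left hij.le]
  -- the values
  · rintro ⟨x, i, j⟩ hq
    obtain ⟨hij, -⟩ := SOMasterLoop.mem_plaquettesIn_iff.mp hq
    have hne : σ i ≠ σ j := fun h => (ne_of_lt hij) (σ.injective h)
    simp only
    rcases lt_or_gt_of_ne hne with hlt | hlt
    · rw [min_eq_left hlt.le, max_eq_right hlt.le, plaquette_permConfig]
    · rw [min_eq_right hlt.le, max_eq_left hlt.le, plaquette_swap, plaquette_permConfig, re_trace_soRep_inv]

/-- ★ **Permutation covariance of the expectations**: for a `σ`-invariant region, `⟨F ∘ σ·⟩_{Λ,N,β} = ⟨F⟩_{Λ,N,β}`.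
[folklore] -/
theorem soExpect_comp_permConfig (σ : Equiv.Perm (Fin d)) {Λ : Finset (Site d)}
    (hΛ : ∀ x : Site d, x ∈ Λ ↔ x ∘ ⇑σ.symm ∈ Λ) (β : ℝ) (F : ZdGaugeConfig d (SO N) → ℝ) :
    soExpect N β Λ (fun U => F (fun e : ZdEdge d => U (e.1 ∘ ⇑σ, σ.symm e.2))) = soExpect N β Λ F := by
  have hρ : Continuous (soRep N) := (isSpecialOrthogonalModel_soRep N).1
  rw [soExpect_eq_zdExpect, soExpect_eq_zdExpect, zdExpect_eq_div_integral (soRep N) hρ,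
    zdExpect_eq_div_integral (soRep N) hρ]
  congr 1
  have h := integral_comp_permConfig (G := SO N) σ (fun U => F U * Real.exp (-(N * β) * zdWilsonAction (soRep N) Λ U))
  simp only [zdWilsonAction_permConfig σ hΛ] at h
  exact h

/-! ## Wilson loop variables -/

/-- **`W_{σl}(σ·U) = W_l(U)`** — the holonomy of the permuted word in the permuted configuration. [folklore] -/
theorem wilsonLoopVar_map_permConfig (σ : Equiv.Perm (Fin d)) (l : List (DEdge d)) (U : ZdGaugeConfig d (SO N)) :
    wilsonLoopVar N (l.map fun a : DEdge d => (((a.1.1 ∘ ⇑σ.symm, σ a.1.2) : ZdEdge d), a.2))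
        (fun e : ZdEdge d => U (e.1 ∘ ⇑σ, σ.symm e.2)) = wilsonLoopVar N l U := by
  unfold wilsonLoopVar Literature.MathematicalPhysics.QuantumFieldTheory.Chatterjee2019LargeN.wordHolonomy
  rw [List.map_map]
  have hmap : ∀ a : DEdge d,
      ((fun a : DEdge d => if a.2 = true then (fun e : ZdEdge d => U (e.1 ∘ ⇑σ, σ.symm e.2)) a.1
          else ((fun e : ZdEdge d => U (e.1 ∘ ⇑σ, σ.symm e.2)) a.1)⁻¹) ∘
        fun a : DEdge d => (((a.1.1 ∘ ⇑σ.symm, σ a.1.2) : ZdEdge d), a.2)) a =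
        (if a.2 = true then U a.1 else (U a.1)⁻¹) := by
    rintro ⟨⟨x, k⟩, b⟩
    simp only [Function.comp_apply, comp_symm_comp, Equiv.symm_apply_apply]
  rw [List.map_congr_left (fun a _ => hmap a)]

/-- **`∂(σp) = σ(∂p)`** when `σ` preserves the order of the two axes of `p = (x, i < j)`. [cite: Chatterjee2019LargeN, §2.1 (the plaquette word)] -/
theorem plaquetteWord_perm (σ : Equiv.Perm (Fin d)) (x : Site d) {i j : Fin d} (hij : i < j) (hσ : σ i < σ j) :
    plaquetteWord ⟨x ∘ ⇑σ.symm, ⟨(σ i, σ j), hσ⟩⟩ =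
      (plaquetteWord ⟨x, ⟨(i, j), hij⟩⟩).map fun a : DEdge d => (((a.1.1 ∘ ⇑σ.symm, σ a.1.2) : ZdEdge d), a.2) := by
  simp only [plaquetteWord, List.map_cons, List.map_nil, add_comp_perm, single_comp_perm_symm]

/-- Permutation covariance with the inverse permutation's configuration map. [folklore] -/
theorem soExpect_comp_permConfig' (σ : Equiv.Perm (Fin d)) {Λ : Finset (Site d)}
    (hΛ : ∀ x : Site d, x ∈ Λ ↔ x ∘ ⇑σ ∈ Λ) (β : ℝ) (F : ZdGaugeConfig d (SO N) → ℝ) :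
    soExpect N β Λ (fun U => F (fun e : ZdEdge d => U (e.1 ∘ ⇑σ.symm, σ e.2))) = soExpect N β Λ F := by
  have hΛ' : ∀ x : Site d, x ∈ Λ ↔ x ∘ ⇑σ.symm.symm ∈ Λ := fun x => by rw [Equiv.symm_symm]; exact hΛ x
  simpa only [Equiv.symm_symm] using soExpect_comp_permConfig (N := N) σ.symm hΛ' β F

/-- ★ **`φ_{Λ,N,β}((∂(σp))) = φ_{Λ,N,β}((∂p))`** for a `σ`-invariant region `Λ` and `σ` preserving the order of the axes of
`p`. [cite: Chatterjee2019LargeN, Corollary 3.4 («Let p be any plaquette»)] -/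
theorem phi_plaquetteWord_perm (σ : Equiv.Perm (Fin d)) {Λ : Finset (Site d)}
    (hΛ : ∀ x : Site d, x ∈ Λ ↔ x ∘ ⇑σ.symm ∈ Λ) (β : ℝ) (x : Site d) {i j : Fin d} (hij : i < j) (hσ : σ i < σ j) :
    phi N β Λ [plaquetteWord ⟨x ∘ ⇑σ.symm, ⟨(σ i, σ j), hσ⟩⟩] = phi N β Λ [plaquetteWord ⟨x, ⟨(i, j), hij⟩⟩] := by
  unfold phi
  congr 1
  -- `W_{∂(σp)} = W_{∂p} ∘ (σ⁻¹·)`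
  have hΛ' : ∀ y : Site d, y ∈ Λ ↔ y ∘ ⇑σ ∈ Λ := fun y => by
    rw [hΛ (y ∘ ⇑σ), comp_comp_symm]
  have key : ∀ U : ZdGaugeConfig d (SO N),
      wilsonProd N [plaquetteWord ⟨x ∘ ⇑σ.symm, ⟨(σ i, σ j), hσ⟩⟩] U =
        wilsonProd N [plaquetteWord ⟨x, ⟨(i, j), hij⟩⟩] (fun e : ZdEdge d => U (e.1 ∘ ⇑σ.symm, σ e.2)) := by
    intro U
    simp only [wilsonProd, List.map_cons, List.map_nil, List.prod_cons, List.prod_nil, mul_one]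
    have h := wilsonLoopVar_map_permConfig (N := N) σ (plaquetteWord ⟨x, ⟨(i, j), hij⟩⟩)
      (fun e : ZdEdge d => U (e.1 ∘ ⇑σ.symm, σ e.2))
    simp only [comp_comp_symm, Equiv.apply_symm_apply, Prod.mk.eta] at h
    rw [plaquetteWord_perm σ x hij hσ]
    exact h
  rw [funext key]
  exact soExpect_comp_permConfig' σ hΛ' β _

end StringDuality

end Summit.QuantumFields.GaugeBoot

end
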